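import Mathlib.RingTheory.Ideal.Quotient.Operations
import Mathlib.RingTheory.Ideal.Maps
import Mathlib.LinearAlgebra.Prod
import Mathlib.LinearAlgebra.Pi
import HarnessLib

/-!
# The image of multiplication by `ϖᵈ` on `(R/ϖ^{e'})^ι ⊕ Q` (`ϖᵈ Q = 0`) is free over `R/ϖ^{e'-d}`, and
# its `ϖʲ`-torsion is divisible by `ϖ^{e'-d-j}` inside it — the ALGEBRA of Howard 2004, Lemma 1.6.3
# («free image») and of the «liftability» step in the proof of Lemma 1.6.4

Topic `Algebra/Module`; namespace `Literature.Algebra.Module`. THEOREMS ONLY: no definition, no named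
fact, no instance, no notation, no `sorry` (net debt 0). Companions (same programme, print leaf G87 =
`Literature.NumberTheory.GaloisCohomology.Howard2004.thm161_dvrKolyvaginBound`):
`PairedTorsionModulesDVR.lean` / `PairedTorsionModulesAlternating.lean` (Thm. 1.4.2, the shape
`N ≅ (R/ϖᵏ)^ε ⊕ M ⊕ M`), `SymplecticTorsionModulesDVR.lean` (Lemma 1.5.7).

## Source, verbatim

B. Howard, *The Heegner point Kolyvagin system*, Compositio Math. 140 (2004) 1439–1472, §1.6
(= arXiv:1202.6340 §2.6, held text `paper:arxiv-1202.6340` p0011 L69–L80 and p0012 L1–L9). `R` is a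
discrete valuation ring with uniformizer `π`, `R^{(k)} = R/𝔪ᵏ`, `T^{(k)} = T/𝔪ᵏT`, and
`H¹_{𝓕(n)}(K, T^{(k)}) ≅ R^{(k),ε} ⊕ M^{(k)}(n) ⊕ M^{(k)}(n)` (Thm. 1.4.2 on the levels):

> **Lemma 1.6.3.** If `n ∈ 𝓝^{(2k-1)}` and `Stub^{(k)}(n) ≠ 0` then the image of
> `H¹_{𝓕(n)}(K, T^{(2k-1)}) → H¹_{𝓕(n)}(K, T^{(k)})` is a free, rank-one `R^{(k)}`-submodule.
> *Proof.* Under the identification `H¹_{𝓕(n)}(K, T^{(k)}) ≅ H¹_{𝓕(n)}(K, T^{(2k-1)})[𝔪ᵏ]` of Lemma (H.5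
> application), the above map is identified with
> `H¹_{𝓕(n)}(K, T^{(2k-1)}) →^{π^{k-1}} H¹_{𝓕(n)}(K, T^{(2k-1)})[𝔪ᵏ]`. The hypothesis `Stub^{(k)}(n) ≠ 0`
> implies that `len_R(M^{(2k-1)}) < k` and that `ε = 1`, hence the image is isomorphic as an `R`-module
> to `𝔪^{k-1}R^{(2k-1)} ≅ R^{(k)}`.

and, in the proof of Lemma 1.6.4 (p0012 L7–L9):

> Appealing again to Lemma (H.5 application), this is equivalent to `π^{k-i} κ_n^{(k)} = 0`. Now by Lemma
> (liftability), `κ_n^{(k)}` is divisible by `πⁱ` in `H¹_{𝓕(n)}(K, T^{(k)})`, proving this special case.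

The arXiv text's «Lemma (liftability)» is a dangling reference; the step IS Lemma 1.6.3: `κ_n^{(k)}` is
the reduction of `κ_n^{(2k-1)}`, hence lies in the free rank-one `R^{(k)}`-module `C =` image, and in
`C ≅ R/𝔪ᵏ` an element killed by `π^{k-i}` is divisible by `πⁱ` (inside `C`).

## What is proved (theorems only; `R` an integral domain, `ϖ ≠ 0` — no DVR hypothesis is needed)

With `P ≃ₗ[R] (ι → R ⧸ I) × Q`, `I = (ϖ^{e'})`, `ϖᵈ • Q = 0` (Howard: `e' = 2k-1`, `d = k-1`, `ι = Fin ε`,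
`Q = M ⊕ M` with `len M ≤ k - 1`), the «image of `π^{k-1}`» is the set of the `ϖᵈ • u`:

* §1 `exists_eq_pow_smul_pow_smul_of_pow_smul_eq_zero_quotient` — in `R/(ϖ^{e'})`:
  `ϖʲ·(ϖᵈ·x) = 0`, `d + j ≤ e'` ⟹ `ϖᵈ·x = ϖ^{e'-d-j}·(ϖᵈ·y)`;
* §2 `exists_eq_pow_smul_pow_smul_of_pow_smul_eq_zero_prod` (the model `(ι → R ⧸ I) × Q`) and
  **`exists_eq_pow_smul_pow_smul_of_pow_smul_eq_zero`** (any `P` isomorphic to it) — THE LIFTABILITY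
  STEP: `ϖʲ·(ϖᵈ·u) = 0`, `d + j ≤ e'` ⟹ `ϖᵈ·u = ϖ^{e'-d-j}·(ϖᵈ·w)` (Howard: `j = k - i`, `e' - d - j = i`);
* §3 **`exists_generator_pow_smul_of_linearEquiv`** — LEMMA 1.6.3's conclusion for `ι` a singleton
  (`ε = 1`): the image `{ϖᵈ·u}` is generated by one element whose annihilator is EXACTLY `(ϖ^{e'-d})`,
  i.e. it is free of rank one over `R/(ϖ^{e'-d})` (Howard: `𝔪^{k-1}R^{(2k-1)} ≅ R^{(k)}`).

For the levels of a π-adic tower with `𝔪 = (π)`, take `I = 𝔪^{e'} = (π^{e'})` (`Ideal.span_singleton_pow`).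
Nothing here concerns Selmer groups; Howard's Lemma 1.6.3 itself (which needs Lemma 1.3.3 and Thm. 1.4.2
on the levels) is NOT claimed — the Galois-side adapter is the companion
`NumberTheory/GaloisCohomology/Howard2004/DVRLevelLiftabilityProofs.lean`.

## References

* [Howard2004HeegnerKolyvagin] B. Howard, *The Heegner point Kolyvagin system*, Compositio Math. 140
  (2004), no. 6, 1439–1472, Lemma 1.6.3 and the proof of Lemma 1.6.4 (arXiv:1202.6340 Lemma 2.6.3,
  p. 11 L69–80; p. 12 L1–9).
-/

open Module Submodule

namespace Literature.Algebra.Module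

/-! ### §1 The computation in the cyclic module `R/(ϖ^{e'})` -/

section QuotientSMul

variable {R : Type*} [CommRing R]

/-- The scalar action of `R` on `R ⧸ I` through representatives: `r • [a] = [r a]`. [folklore] -/
private theorem smul_mk_eq_mk_mul (I : Ideal R) (r a : R) :
    r • Ideal.Quotient.mk I a = Ideal.Quotient.mk I (r * a) := by
  rw [Algebra.smul_def, Ideal.Quotient.algebraMap_eq, map_mul]

/-- `r • 1 = [r]` in `R ⧸ I`. [folklore] -/
private theorem smul_one_eq_mk (I : Ideal R) (r : R) :
    r • (1 : R ⧸ I) = Ideal.Quotient.mk I r := by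
  rw [Algebra.smul_def, mul_one, Ideal.Quotient.algebraMap_eq]

end QuotientSMul

section Quotient

variable {R : Type*} [CommRing R] [IsDomain R] {ϖ : R}

/-- Cancellation of a power of a non-zero element of a domain inside a principal ideal:
`ϖᵃ r ∈ (ϖ^{a+b})` forces `r ∈ ϖᵇ R`. [folklore] -/
private theorem exists_eq_pow_mul_of_pow_mul_mem_span (hϖ : ϖ ≠ 0) {a b : ℕ} {r : R}
    (h : ϖ ^ a * r ∈ Ideal.span {ϖ ^ (a + b)}) : ∃ s : R, r = ϖ ^ b * s := by
  obtain ⟨s, hs⟩ := Ideal.mem_span_singleton'.1 h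
  refine ⟨s, mul_left_cancel₀ (pow_ne_zero a hϖ) ?_⟩
  rw [← hs, pow_add]
  ring

/-- **In `R/(ϖ^{e'})`, the `ϖʲ`-torsion of `ϖᵈ·(R/(ϖ^{e'}))` is `ϖ^{e'-d-j}·(ϖᵈ·(R/(ϖ^{e'})))`**
(`d + j ≤ e'`; `R` a domain, `ϖ ≠ 0`): if `ϖʲ (ϖᵈ x) = 0` then `ϖᵈ x = ϖ^{e'-d-j} (ϖᵈ y)` for some `y`
— writing `x = [r]`, `ϖ^{d+j} r ∈ (ϖ^{e'})` gives `r = ϖ^{e'-d-j} s`.  Howard's «`𝔪^{k-1}R^{(2k-1)} ≅ R^{(k)}`»: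
inside the cyclic module `ϖᵈ·R/(ϖ^{e'}) ≅ R/(ϖ^{e'-d})` an element killed by `ϖʲ` is divisible by
`ϖ^{(e'-d)-j}`. [cite: Howard2004HeegnerKolyvagin, Lemma 1.6.3 (proof) and Lemma 1.6.4 (proof) = arXiv:1202.6340 Lemma 2.6.3, p0011 L74–L80; p0012 L7–L9] -/
theorem exists_eq_pow_smul_pow_smul_of_pow_smul_eq_zero_quotient (hϖ : ϖ ≠ 0) {e' d j : ℕ}
    (hdj : d + j ≤ e') (x : R ⧸ Ideal.span {ϖ ^ e'}) (h0 : ϖ ^ j • ϖ ^ d • x = 0) :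
    ∃ y : R ⧸ Ideal.span {ϖ ^ e'}, ϖ ^ d • x = ϖ ^ (e' - d - j) • ϖ ^ d • y := by
  obtain ⟨r, rfl⟩ := Ideal.Quotient.mk_surjective x
  rw [smul_mk_eq_mk_mul, smul_mk_eq_mk_mul, Ideal.Quotient.eq_zero_iff_mem, ← mul_assoc, ← pow_add]
    at h0
  have he : e' = (j + d) + (e' - d - j) := by omega
  rw [he] at h0
  obtain ⟨s, hs⟩ := exists_eq_pow_mul_of_pow_mul_mem_span hϖ h0
  refine ⟨Ideal.Quotient.mk _ s, ?_⟩
  rw [smul_mk_eq_mk_mul, smul_mk_eq_mk_mul, smul_mk_eq_mk_mul, hs]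
  congr 1
  ring

end Quotient

/-! ### §2 The liftability step on `(ι → R/I) × Q`, `I = (ϖ^{e'})`, `ϖᵈ Q = 0`, and on any module isomorphic to it -/

section Prod

variable {R : Type*} [CommRing R] [IsDomain R] {ϖ : R} {I : Ideal R} {e' d j : ℕ}
  {ι : Type*} {Q : Type*} [AddCommGroup Q] [Module R Q]

/-- **The liftability step on the model `(ι → R/(ϖ^{e'})) × Q` with `ϖᵈ Q = 0`** (`d + j ≤ e'`): an element
`ϖᵈ u` killed by `ϖʲ` is `ϖ^{e'-d-j} (ϖᵈ w)` — componentwise §1 on the free part, and the `Q`-part of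
`ϖᵈ u` vanishes.  (Howard: `(ι → R/(ϖ^{e'})) × Q = R^{(2k-1),ε} ⊕ M ⊕ M` with `len M ≤ k - 1 = d`, so
`π^{k-1}` kills `M ⊕ M`; no restriction on `ε` is needed for this step.)
[cite: Howard2004HeegnerKolyvagin, Lemma 1.6.3 and Lemma 1.6.4 (proof) = arXiv:1202.6340, p0011 L69–L80; p0012 L1–L9] -/
theorem exists_eq_pow_smul_pow_smul_of_pow_smul_eq_zero_prod (hϖ : ϖ ≠ 0)
    (hI : I = Ideal.span {ϖ ^ e'}) (hdj : d + j ≤ e') (hQ : ∀ q : Q, ϖ ^ d • q = 0)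
    (u : (ι → R ⧸ I) × Q) (h0 : ϖ ^ j • ϖ ^ d • u = 0) :
    ∃ w : (ι → R ⧸ I) × Q, ϖ ^ d • u = ϖ ^ (e' - d - j) • ϖ ^ d • w := by
  subst hI
  have h1 : ∀ i, ∃ y : R ⧸ Ideal.span {ϖ ^ e'}, ϖ ^ d • u.1 i = ϖ ^ (e' - d - j) • ϖ ^ d • y := by
    intro i
    refine exists_eq_pow_smul_pow_smul_of_pow_smul_eq_zero_quotient hϖ hdj (u.1 i) ?_
    have := congrArg (fun z => z.1 i) h0
    simpa using this
  choose y hy using h1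
  refine ⟨(y, 0), Prod.ext (funext fun i => ?_) ?_⟩
  · simpa using hy i
  · simp [hQ]

/-- **THE LIFTABILITY STEP (Howard 2004, proof of Lemma 1.6.4, «by Lemma (liftability)» = Lemma 1.6.3):**
for any `R`-module `P ≅ (ι → R/(ϖ^{e'})) × Q` with `ϖᵈ Q = 0` and `d + j ≤ e'` (`R` a domain, `ϖ ≠ 0`),
an element of the image `ϖᵈ P` killed by `ϖʲ` is divisible by `ϖ^{e'-d-j}` INSIDE `ϖᵈ P`:
`ϖʲ (ϖᵈ u) = 0 ⟹ ϖᵈ u = ϖ^{e'-d-j} (ϖᵈ w)`.  In print (`e' = 2k-1`, `d = k-1`, `j = k-i`):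
«`π^{k-i} κ_n^{(k)} = 0` … `κ_n^{(k)}` is divisible by `πⁱ`», `κ_n^{(k)} = red(κ_n^{(2k-1)})` lying in the
image of `π^{k-1}` under the identification of Lemma 1.3.3.
[cite: Howard2004HeegnerKolyvagin, Lemma 1.6.3 and Lemma 1.6.4 (proof) = arXiv:1202.6340, p0011 L69–L80; p0012 L1–L9] -/
theorem exists_eq_pow_smul_pow_smul_of_pow_smul_eq_zero {P : Type*} [AddCommGroup P] [Module R P]
    (hϖ : ϖ ≠ 0) (hI : I = Ideal.span {ϖ ^ e'}) (hdj : d + j ≤ e')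
    (f : P ≃ₗ[R] (ι → R ⧸ I) × Q) (hQ : ∀ q : Q, ϖ ^ d • q = 0)
    (u : P) (h0 : ϖ ^ j • ϖ ^ d • u = 0) :
    ∃ w : P, ϖ ^ d • u = ϖ ^ (e' - d - j) • ϖ ^ d • w := by
  have h0' : ϖ ^ j • ϖ ^ d • f u = 0 := by
    rw [← map_smul, ← map_smul, h0, map_zero]
  obtain ⟨w, hw⟩ := exists_eq_pow_smul_pow_smul_of_pow_smul_eq_zero_prod hϖ hI hdj hQ (f u) h0'
  refine ⟨f.symm w, f.injective ?_⟩
  rw [map_smul, hw, map_smul, map_smul, LinearEquiv.apply_symm_apply]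

end Prod

/-! ### §3 Lemma 1.6.3's conclusion: for `ι` a singleton the image `ϖᵈ P` is free of rank one over `R/(ϖ^{e'-d})` -/

section FreeImage

variable {R : Type*} [CommRing R] [IsDomain R] {ϖ : R} {I : Ideal R} {e' d : ℕ}
  {ι : Type*} [Unique ι] {Q : Type*} [AddCommGroup Q] [Module R Q]
  {P : Type*} [AddCommGroup P] [Module R P]

/-- **Howard 2004, Lemma 1.6.3 («free image»), the algebra:** for `P ≅ (ι → R/(ϖ^{e'})) × Q` with `ι` a
singleton (`ε = 1`), `ϖᵈ Q = 0` and `d ≤ e'` (`R` a domain, `ϖ ≠ 0`), the image `ϖᵈ P = {ϖᵈ u}` is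
generated by ONE element `c = ϖᵈ u₀` whose annihilator is EXACTLY `(ϖ^{e'-d})` — i.e. `ϖᵈ P` is a free
rank-one `R/(ϖ^{e'-d})`-module.  In print: «the image is isomorphic as an `R`-module to
`𝔪^{k-1}R^{(2k-1)} ≅ R^{(k)}`» (`e' = 2k-1`, `d = k-1`, `Q = M^{(2k-1)} ⊕ M^{(2k-1)}` killed by `π^{k-1}`
since `len_R M^{(2k-1)} < k`). [cite: Howard2004HeegnerKolyvagin, Lemma 1.6.3 = arXiv:1202.6340 Lemma 2.6.3, p0011 L69–L80] -/
theorem exists_generator_pow_smul_of_linearEquiv (hϖ : ϖ ≠ 0) (hI : I = Ideal.span {ϖ ^ e'})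
    (hd : d ≤ e') (f : P ≃ₗ[R] (ι → R ⧸ I) × Q) (hQ : ∀ q : Q, ϖ ^ d • q = 0) :
    ∃ c : P, (∃ u₀ : P, c = ϖ ^ d • u₀) ∧ (∀ u : P, ∃ r : R, ϖ ^ d • u = r • c) ∧
      ∀ r : R, r • c = 0 ↔ r ∈ Ideal.span {ϖ ^ (e' - d)} := by
  subst hI
  refine ⟨ϖ ^ d • f.symm (fun _ => 1, 0), ⟨_, rfl⟩, fun u => ?_, fun r => ?_⟩
  · -- every `ϖᵈ u` is a multiple of `c`
    obtain ⟨r, hr⟩ := Ideal.Quotient.mk_surjective ((f u).1 default)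
    refine ⟨r, f.injective ?_⟩
    rw [map_smul, map_smul, map_smul, LinearEquiv.apply_symm_apply]
    refine Prod.ext (funext fun i => ?_) ?_
    · have hi : i = default := Subsingleton.elim _ _
      subst hi
      change ϖ ^ d • (f u).1 default = r • ϖ ^ d • (1 : R ⧸ Ideal.span {ϖ ^ e'})
      rw [← hr, smul_one_eq_mk, smul_mk_eq_mk_mul, smul_mk_eq_mk_mul, mul_comm]
    · change ϖ ^ d • (f u).2 = r • ϖ ^ d • (0 : Q)
      rw [hQ, smul_zero, smul_zero]
  · -- the annihilator of `c` is `(ϖ^{e'-d})`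
    constructor
    · intro h
      have h1 := congrArg f h
      rw [map_smul, map_smul, LinearEquiv.apply_symm_apply, map_zero] at h1
      have h2 := congrArg (fun z => z.1 default) h1
      change r • ϖ ^ d • (1 : R ⧸ Ideal.span {ϖ ^ e'}) = 0 at h2
      rw [smul_one_eq_mk, smul_mk_eq_mk_mul, Ideal.Quotient.eq_zero_iff_mem, mul_comm] at h2
      have he : e' = d + (e' - d) := by omega
      rw [he] at h2
      obtain ⟨s, hs⟩ := exists_eq_pow_mul_of_pow_mul_mem_span hϖ h2
      exact Ideal.mem_span_singleton'.2 ⟨s, by rw [hs, mul_comm]⟩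
    · intro h
      obtain ⟨s, rfl⟩ := Ideal.mem_span_singleton'.1 h
      apply f.injective
      rw [map_smul, map_smul, LinearEquiv.apply_symm_apply, map_zero]
      refine Prod.ext (funext fun i => ?_) ?_
      · change (s * ϖ ^ (e' - d)) • ϖ ^ d • (1 : R ⧸ Ideal.span {ϖ ^ e'}) = 0
        rw [smul_one_eq_mk, smul_mk_eq_mk_mul, Ideal.Quotient.eq_zero_iff_mem]
        exact Ideal.mem_span_singleton'.2 ⟨s, by rw [mul_assoc, ← pow_add, Nat.sub_add_cancel hd]⟩
      · change (s * ϖ ^ (e' - d)) • ϖ ^ d • (0 : Q) = 0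
        rw [smul_zero, smul_zero]

end FreeImage

end Literature.Algebra.Module
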